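import Literature.NumberTheory.FaltingsSerre.CoreCertificate
import Literature.NumberTheory.FaltingsSerre.Paramodular353
import HarnessLib

/-!
# The Faltings–Serre method after Brumer–Pacetti–Poor–Tornaría–Voight–Yuen:
# the instance `N = 353` (image `S₃ ≀ S₂`) in CORE form — the trace table leaves the hash

[BPPTVY] = A. Brumer, A. Pacetti, C. Poor, G. Tornaría, J. Voight, D. S. Yuen, *On the paramodularity of
typical abelian surfaces*, Algebra & Number Theory **13**:5 (2019) 1145–1195 [cite: BrumerEtAl2019]
(PRINTED numbering and pages): §7.2 pp. 1189–1190, Theorem 7.2.1 (the Jacobian `A₃₅₃` of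
`C₃₅₃ : y² + (x³+x+1)y = x²`, LMFDB `353.a.353.1`, is paramodular of level `353`; residual image
`S₃ ≀ S₂`; printed check set `P(353) = {3,5,7,11,13,19,23,29,31,37,41,43,53,97,137}`); Algorithm 2.4.1
p. 1156 (Steps 1–5); Theorem 4.3.4 p. 1169 ((iii) `ρ_{f,ℓ}` unramified outside `ℓN`, (iv) the Euler
factors of `ρ_{f,ℓ}`); §7.1 p. 1188 (Step 5: "to conclude we will show that
`tr ρ_A(Frob_p) = tr ρ_f(Frob_p)` for all `p`" in the check set).

WHAT THIS FILE IS.  The `N = 353` instance of the CORE-form template `paramodular_of_coreCertificate`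
(`CoreCertificate.lean`), in exactly the shape of the worked instance
`Paramodular349.paramodular_349_of_coreCertificate`: the certificate hypothesis `CoreCertificate353`
ATTESTS ONLY the five blocks a certificate file must attest — the two similitude identities
[(4.1.3) p. 1163; Thm 4.3.4 (ii)], Step 1 up to frame (`∃ π ∈ S₆, ρ̄_f = ι(π) ρ̄_A ι(π)⁻¹`), absolute
irreducibility of `ρ̄_A` (image `S₃ ≀ S₂`, Lemma 5.1.7 / Lemma 5.2.1) and Steps 2–4 (`complete`: class
field theory for `ρ̄_A` with `S` = places over `{2, 353}`, the twenty extension groups of Thm 5.3.3(a),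
the obstruction/witness search, check primes `checkPrimes353`) — while the Step-5 trace table is the
VISIBLE integer hypothesis `h5 : ∀ p ∈ checkPrimes353, aA p = af p`, the Euler data are `hA` / `hfe`,
unramifiedness of `ρ_A` is DERIVED from `hA` (`isUnramifiedAt_of_hasGoodEulerFactors`) and that of
`ρ_f` is the cited input [Thm 4.3.4 (iii)] (`hρf_unr`).  The check-prime set is the landed
`Paramodular353.checkPrimes353 = {3,5,7,11,13,19,37,41,97,137}` (`Paramodular353.lean`, the cell's
complete finest-invariant witness set, a SUBSET of the printed fifteen primes); `checkPrimes353_good`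
(every check prime is an odd prime not dividing `353`, by `decide`) discharges the template's `hT`.

The certificate hypothesis is discharged OUTSIDE THE KERNEL by the cell's frozen, referee-certified
merged certificate `certs/353/certificate.canonical.json`, sha256
`f9c58454c0fee8091a6b9e1fefbb18ffc9cb091db6d4d5113f028da54859e767` (REFEREE.md ruling S44, freeze
audit A1–A10 = Audit 75; every load-bearing datum by two independent implementations, GRH-free), read
WITHOUT its `trace_check` block (that block is `h5`) and without `unramified` (derived / cited, as
said).  This is an independent machine RE-CERTIFICATION of the PUBLISHED [BPPTVY, Thm 7.2.1] — the
cell's second re-certification of a printed theorem, not a new result; no new mathematics is proved in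
this file (a one-line specialisation of the template; the criterion itself, [Thm 2.1.5], is the tree
theorem `traceEq_of_faltingsSerre_symplectic_holds`, consumed inside `paramodular_of_coreCertificate`).
Companion files for the same level: `Paramodular353.lean` (`paramodular_353`, the `SurfaceCertificate`
form with the criterion as a binder), `Paramodular353Holds.lean` (`paramodular_353_holds`, criterion
discharged), `KernelResidualExclusion353.lean` / `KernelImage353.lean` (kernel-decided residual data).

## References
* [BPPTVY] Thm 7.2.1 p. 1189, §7.2 p. 1190; Alg 2.4.1 p. 1156; Thm 2.1.5 p. 1150; (4.1.3)–(4.1.5)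
  pp. 1163–1164; Thm 4.3.4 p. 1169; §7.1 p. 1188. [cite: BrumerEtAl2019]
* [PY15] C. Poor, D. S. Yuen, *Paramodular cusp forms*, Math. Comp. 84 (2015) 1401–1438, Thm 1.2
  p. 1402 and Table 5 p. 1433 (the nonlift eigenform `f₃₅₃`). [cite: PoorYuen2015]
-/

noncomputable section

namespace Literature.NumberTheory.FaltingsSerre.Paramodular353

open Polynomial IsDedekindDomain Field Literature.NumberTheory.FaltingsSerre
  Literature.NumberTheory.GaloisRepresentations Literature.NumberTheory.FaltingsSerre.GSp4F2
  Literature.NumberTheory.Automorphic.Paramodular Literature.NumberTheory.Automorphic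
  Literature.AlgebraicGeometry.Motives
open scoped NumberField

/-- The ten check primes `checkPrimes353 = {3, 5, 7, 11, 13, 19, 37, 41, 97, 137}` of the frozen
`N = 353` certificate (`Paramodular353.lean`, sha256 `f9c58454c0fee809…`) are good odd primes: prime,
`∤ 353`, `≠ 2` — the hypothesis `hT` of `paramodular_of_coreCertificate` (Step 4 searches witnesses
among primes outside `S = {2, 353}`). [cite: BrumerEtAl2019, Alg 2.4.1 Step 4 p. 1156; §7.2 p. 1190] -/
theorem checkPrimes353_good : ∀ p ∈ checkPrimes353, p.Prime ∧ ¬ p ∣ 353 ∧ p ≠ 2 := by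
  decide

/-- **The `N = 353` core certificate, as a hypothesis**: `CoreCertificate 353 checkPrimes353 ν ρA ρf` —
the blocks `similitude` [(4.1.3); Thm 4.3.4 (ii)], `residual` (Step 1 up to frame: image `S₃ ≀ S₂`,
`ℚ(A[2])` = splitting field of the `2`-division sextic, LMFDB `6.0.22592.1`, `ρ̄_f ≃ ρ̄_A` by the
residual sieve on `Q₅`, `Q₁₁ (mod 2)` ×2 and independently by Route E; absolute irreducibility of
`ρ̄_A`), `classfield` + `group_theory` + `obstructing` (`K₀` of degree `18`, `Cl_S(K₀) = 1` GRH-free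
twice, `65535` quadratic extensions, the `20` extension groups of [Thm 5.3.3(a)] recomputed ×2,
finest-invariant witness search complete with check primes `checkPrimes353`) of the frozen merged
certificate `certs/353/certificate.canonical.json`
(sha256 `f9c58454c0fee8091a6b9e1fefbb18ffc9cb091db6d4d5113f028da54859e767`, referee ruling S44),
WITHOUT its `trace_check` block (now the hypothesis `h5` of `paramodular_353_of_coreCertificate`) and
without `unramified` (curve side derived from `hA`, form side the cited [Thm 4.3.4 (iii)]).  Never a
Literature fact: a `Prop` used as a binder. [cite: BrumerEtAl2019, Alg 2.4.1 p. 1156; §2.3 p. 1149; Thm 7.2.1 p. 1189] -/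
def CoreCertificate353 (ν : absoluteGaloisGroup ℚ → ℤ_[2]) (ρA ρf : FramedGaloisRep ℚ ℤ_[2] 4) : Prop :=
  CoreCertificate 353 checkPrimes353 ν ρA ρf

/-- A `353` certificate up to frame (`SurfaceConjCertificate`, eight fields) contains the core
certificate (five fields): the forgetful direction, so every discharge of the older schema serves this
one. [cite: BrumerEtAl2019, Alg 2.4.1 p. 1156] -/
theorem coreCertificate353_of_surfaceConjCertificate {ν : absoluteGaloisGroup ℚ → ℤ_[2]}
    {ρA ρf : FramedGaloisRep ℚ ℤ_[2] 4} (hC : SurfaceConjCertificate 353 checkPrimes353 ν ρA ρf) :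
    CoreCertificate353 ν ρA ρf :=
  CoreCertificate.ofSurfaceConjCertificate hC

/-- A strict `353` certificate (`Certificate353` of `Paramodular353.lean`) with Gram matrix
`J = antiIdAlt4 ℤ_[2]` contains the core certificate. [cite: BrumerEtAl2019, Alg 2.4.1 p. 1156] -/
theorem coreCertificate353_of_certificate353 {ν : absoluteGaloisGroup ℚ → ℤ_[2]}
    {ρA ρf : FramedGaloisRep ℚ ℤ_[2] 4} (hC : Certificate353 (antiIdAlt4 ℤ_[2]) ν ρA ρf) :
    CoreCertificate353 ν ρA ρf :=
  CoreCertificate.ofSurfaceConjCertificate (ConjCertificate.ofCertificate hC)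

variable {ν : absoluteGaloisGroup ℚ → ℤ_[2]} {ρA ρf : FramedGaloisRep ℚ ℤ_[2] 4}
  {A : AbelianVariety ℚ} {b : Module.Basis (Fin 4) ℚ_[2] (A.rationalTateModule 2)}
  {f : Matrix (Fin 2) (Fin 2) ℂ → ℂ}

/-- **`A₃₅₃` is paramodular of level `353` away from `353`, from the core certificate and the trace
table** ([BPPTVY, Thm 7.2.1], re-certified; kernel target in core form).  `paramodular_of_coreCertificate`
with `N = 353`, `T = checkPrimes353` (`hT` discharged by `checkPrimes353_good`).  Binders: `hC` the core
certificate (sha256 above); `hframe` the Tate-module frame of `A` [(4.1.3)]; `aA bA` / `af bf` the Euler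
data of `A` / `f` at the primes `p ≠ 353` in surface shape `L_p = 1 − aT + bT² − paT³ + p²T⁴` [(4.1.5),
(4.2.18)] with `hA` (good reduction and these Euler factors — where `cond(A) = 353` enters) and `hfe`
(the spinor Euler factors of `f`); `hρf_unr` [Thm 4.3.4 (iii)] and `hρf` [Thm 4.3.4 (iv)] for the framed
`ρ_{f,2}` (cited, Arthur-dependent inputs); `h5 : ∀ p ∈ checkPrimes353, aA p = af p` the Step-5 trace
table (`a_p(A₃₅₃) = a_p(f₃₅₃) = −2, 1, 0, 2, −1, −6, 5, 6, −11, −9` at `p = 3, …, 137`, frozen ×2 in the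
certificate's `trace_check` block and closed by `decide` on those integers by any consumer); `hcusp`,
`hne` (`f ∈ S₂(K(353))` nonzero; `dim = 1` [PY15, Thm 1.2]); `h2` the hand check `L₂(A,T) = Q₂(f,T)`
(`a₂ = −1`, `b₂ = 3` both sides).  Proof: one line. [cite: BrumerEtAl2019, Thm 7.2.1 p. 1189; Thm 2.1.5 p. 1150; Alg 2.4.1 p. 1156; Thm 4.3.4 p. 1169; §7.1 p. 1188] -/
theorem paramodular_353_of_coreCertificate (hC : CoreCertificate353 ν ρA ρf)
    (hframe : A.IsFrameOfTateRep 2 b (rationalize ρA)) (aA bA af bf : ℕ → ℤ)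
    (hA : ∀ p : ℕ, p.Prime → ¬ p ∣ 353 →
      A.HasGoodEulerFactorAt p ((lPolynomialOfSurface p (aA p) (bA p)).map (Int.castRingHom ℚ)))
    (hρf_unr : ∀ v ∉ placesOver (badPrimes 353), ρf.IsUnramifiedAt v)
    (hρf : ∀ p : ℕ, p.Prime → ¬ p ∣ 353 → p ≠ 2 →
      ∀ v : HeightOneSpectrum (𝓞 ℚ), ((p : ℕ) : 𝓞 ℚ) ∈ v.asIdeal →
        ρf.HasFrobCharpolyAt v
          ((lPolynomialOfSurface p (af p) (bf p)).reverse.map (Int.castRingHom ℤ_[2])))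
    (h5 : ∀ p ∈ checkPrimes353, aA p = af p)
    (hcusp : IsParamodularCuspForm 353 2 f) (hne : ∃ Z ∈ siegelUpperHalfSpace 2, f Z ≠ 0)
    (hfe : ∀ p : ℕ, p.Prime → ¬ p ∣ 353 →
      HasSpinorEulerFactorAt 2 p f ((lPolynomialOfSurface p (af p) (bf p)).map (Int.castRingHom ℂ)))
    (h2 : aA 2 = af 2 ∧ bA 2 = bf 2) :
    IsParamodularAwayFrom A 353 f :=
  paramodular_of_coreCertificate hC hframe aA bA af bf hA hρf_unr hρf checkPrimes353_good h5 hcusp hne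
    hfe (fun _ => h2)

/-- The conclusion at one prime `p ≠ 353`, core form: one polynomial is both `L_p(A₃₅₃,T)` and
`Q_p(f₃₅₃,T)`. [cite: BrumerEtAl2019, Thm 7.2.1 p. 1189 (shape of the statement)] -/
theorem eulerFactors_agree_353_of_coreCertificate (hC : CoreCertificate353 ν ρA ρf)
    (hframe : A.IsFrameOfTateRep 2 b (rationalize ρA)) (aA bA af bf : ℕ → ℤ)
    (hA : ∀ p : ℕ, p.Prime → ¬ p ∣ 353 →
      A.HasGoodEulerFactorAt p ((lPolynomialOfSurface p (aA p) (bA p)).map (Int.castRingHom ℚ)))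
    (hρf_unr : ∀ v ∉ placesOver (badPrimes 353), ρf.IsUnramifiedAt v)
    (hρf : ∀ p : ℕ, p.Prime → ¬ p ∣ 353 → p ≠ 2 →
      ∀ v : HeightOneSpectrum (𝓞 ℚ), ((p : ℕ) : 𝓞 ℚ) ∈ v.asIdeal →
        ρf.HasFrobCharpolyAt v
          ((lPolynomialOfSurface p (af p) (bf p)).reverse.map (Int.castRingHom ℤ_[2])))
    (h5 : ∀ p ∈ checkPrimes353, aA p = af p)
    (hcusp : IsParamodularCuspForm 353 2 f) (hne : ∃ Z ∈ siegelUpperHalfSpace 2, f Z ≠ 0)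
    (hfe : ∀ p : ℕ, p.Prime → ¬ p ∣ 353 →
      HasSpinorEulerFactorAt 2 p f ((lPolynomialOfSurface p (af p) (bf p)).map (Int.castRingHom ℂ)))
    (h2 : aA 2 = af 2 ∧ bA 2 = bf 2) {p : ℕ} (hp : p.Prime) (hpN : p ≠ 353) :
    ∃ Q : Polynomial ℚ, HasSpinorEulerFactorAt 2 p f (Q.map (algebraMap ℚ ℂ)) ∧
      A.HasGoodEulerFactorAt p Q :=
  eulerFactors_agree_353
    (paramodular_353_of_coreCertificate hC hframe aA bA af bf hA hρf_unr hρf h5 hcusp hne hfe h2) hp hpN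

end Literature.NumberTheory.FaltingsSerre.Paramodular353

end
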